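import Literature.Topology.FourManifolds.BasinPush
import Literature.Topology.FourManifolds.BasinFlow
import HarnessLib

/-!
# The basin setting: tops of trajectories, level points, and the transport of a boundary map
# to the level `L`

Topic `Literature/Topology/FourManifolds`; fourth file of the endgame of the Torelli half of
Griffiths' handlebody theorem.  Everything here is **proved**.

For `B : BasinSetting g ξ`:
* `BasinSetting.top x` — the point of the trajectory of `x` on the level `L` (Milnor's
  projection along trajectories, `Flow.levelProj`), constant along trajectories, smooth at the
  points of `{g < 1}` hitting `L`; `levelProj θ g ℓ w` for `w ∈ L ∩ basin` is THE point of level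
  `ℓ ∈ (g p₀, hi)` on the trajectory of `w` (`levelProj_eq_of_apply_θ_eq`, uniqueness along
  non-critical trajectories, `SlabHittingTime.lean`), its top is `w`, and a point hitting `L`
  is the level point, at its own level, of its top (`levelProj_top_self`);
* `BasinSetting.ret`, `BasinSetting.bret` — the boundary point below a point of the collar;
  `push_ret_of_apply_eq_L`: a point of `L` is the push of its boundary point;
* `BasinSetting.transport χ` — **the transport to `L` of a self-map `χ` of `∂W`**,
  `w ↦ push (χ (bret w))`: `transport χ (push y) = push (χ y)`, transports compose, the
  transport of a left inverse inverts on `L`, the transport of a map preserving the traces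
  preserves `L ∩ basin` (`transport_mem_basin`, via `coe_mem_unstableSet_iff`), and it fixes
  the points whose boundary point is fixed.

## References

* J. Milnor, *Lectures on the h-cobordism theorem*, notes by L. Siebenmann and J. Sondow,
  Princeton Mathematical Notes (1965): Def. 3.1, proof of Thm. 3.4 (PDF pp. 11–13), Def. 3.9
  (PDF p. 16), Thm. 4.1 (PDF p. 22), proof of Thm. 5.4, Assertion 4 (PDF p. 29).
  [MilnorHCobordism1965]
* J. Milnor, *Morse theory* (1963), Thm. 3.1 and proof of Thm. 4.1 (p. 25). [Milnor1963]
* H. B. Griffiths, *Automorphisms of a 3-dimensional handlebody*, Abh. Math. Sem. Univ. Hamburg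
  26 (1964), §§3–6. [GriffithsHB1964Handlebody]
-/

open scoped Manifold ContDiff Topology
open Set Function Filter Metric

noncomputable section

namespace Literature.Topology.FourManifolds

open Cobordism FourManifolds.Flow

universe u

variable {n : ℕ} {W : Type u} [TopologicalSpace W] [T2Space W] [SecondCountableTopology W]
  [CompactSpace W] [ChartedSpace (EuclideanHalfSpace (n + 1)) W] [IsManifold (𝓡∂ (n + 1)) ∞ W]

/-! ### Level points, the top of a trajectory, and the transport of a boundary map to the level `L` -/

namespace BasinSetting

variable {g : W → ℝ} {ξ : Π x : W, TangentSpace (𝓡∂ (n + 1)) x} (B : BasinSetting g ξ)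

/-- **The top** of the trajectory of `x`: its point on the level `L` (junk, `x` itself, if the
trajectory misses `L`). [cite: MilnorHCobordism1965, Thm. 4.1 (PDF p. 22)] -/
def top (x : W) : W := levelProj B.θ g B.L x

/-- Unfolding `top`. [folklore] -/
theorem top_def (x : W) : B.top x = B.θ (hittingTime B.θ g B.L x, x) := rfl

/-- The top lies on the level `L`. [folklore] -/
theorem apply_top {x : W} (hx : Hits B.θ g B.L x) : g (B.top x) = B.L := apply_hittingTime hx

/-- The top of a point of `L` is the point itself. [folklore] -/
theorem top_of_apply_eq {w : W} (hw : g w = B.L) : B.top w = w := by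
  rw [top_def, B.hittingTime_L_eq (t := 0) (by rw [B.θ_zero]; exact hw), B.θ_zero]

/-- **The top is constant along trajectories.** [cite: MilnorHCobordism1965, Thm. 4.1 (PDF p. 22)] -/
theorem top_θ {x : W} (hx : Hits B.θ g B.L x) (t : ℝ) : B.top (B.θ (t, x)) = B.top x :=
  B.isSmoothFlow.proj_apply B.preSlabFlow.mdifferentiable_f B.transversal_L hx t

/-- `x` is recovered from its top by flowing back: `x = θ (-τ_L x, top x)`. [folklore] -/
theorem θ_neg_hittingTime_top (x : W) : B.θ (-hittingTime B.θ g B.L x, B.top x) = x := by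
  rw [top_def, B.θ_add, neg_add_cancel, B.θ_zero]

/-- The top is smooth at every point of `{g < 1}` hitting `L`. [cite: MilnorHCobordism1965, Thm. 4.1 (PDF p. 22)] -/
theorem contMDiffAt_top {x : W} (hx : g x < 1) (hhit : Hits B.θ g B.L x) :
    ContMDiffAt (𝓡∂ (n + 1)) (𝓡∂ (n + 1)) ∞ B.top x :=
  B.isSmoothFlow.contMDiffAt_proj B.isMorseFunction.isMorse.contMDiff B.transversal_L hhit
    (B.isInteriorPoint_of_lt hx)

/-- The hitting time of `L` is smooth at every point of `{g < 1}` hitting `L`. [cite: MilnorHCobordism1965, proof of Thm. 5.4, Assertion 4 (PDF p. 29)] -/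
theorem contMDiffAt_hittingTime_L {x : W} (hx : g x < 1) (hhit : Hits B.θ g B.L x) :
    ContMDiffAt (𝓡∂ (n + 1)) 𝓘(ℝ, ℝ) ∞ (hittingTime B.θ g B.L) x :=
  B.isSmoothFlow.contMDiffAt_hittingTime B.isMorseFunction.isMorse.contMDiff B.transversal_L hhit
    (B.isInteriorPoint_of_lt hx)

/-- A point hitting `L` lies in the basin iff its top does (flow invariance of the basin), for
points of `{g ≤ hi}`. [cite: MilnorHCobordism1965, Def. 3.9 (PDF p. 16)] -/
theorem top_mem_basin_iff {x : W} (hx : g x ≤ B.hi) (hhit : Hits B.θ g B.L x) :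
    B.top x ∈ B.basin ↔ x ∈ B.basin :=
  B.θ_mem_basin_iff hx (by rw [← top_def, B.apply_top hhit]; exact B.L_lt_hi.le)

/-! #### Level points on a basin trajectory through `L` -/

/-- **The level point** of level `ℓ` on the trajectory of `w`: `levelProj θ g ℓ w`; for
`w ∈ L ∩ basin` and `ℓ ∈ (g p₀, hi)` it is THE point of that trajectory with `g = ℓ`. [cite: MilnorHCobordism1965, Thm. 4.1 (PDF p. 22)] -/
theorem apply_levelProj_of_mem_basin {w : W} (hw : w ∈ B.basin) (hwL : g w = B.L) {ℓ : ℝ}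
    (hℓ : ℓ ∈ Ioo (g B.p₀) B.hi) : g (levelProj B.θ g ℓ w) = ℓ :=
  apply_hittingTime (B.hits_of_mem_basin_of_apply_eq_L hw hwL hℓ)

/-- `Ioo (g p₀) hi ⊆ Icc lo hi`. [folklore] -/
theorem Ioo_subset_slab : Ioo (g B.p₀) B.hi ⊆ Icc B.lo B.hi := fun _ h =>
  ⟨(B.lo_lt_apply_p₀.trans h.1).le, h.2.le⟩

/-- **Uniqueness of level points along a trajectory of `L`**: if `θ (t, w)` has level
`ℓ ∈ (g p₀, hi)` then it is the level point. [cite: MilnorHCobordism1965, Thm. 4.1 (PDF p. 22)] -/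
theorem levelProj_eq_of_apply_θ_eq {w : W} (hwL : g w = B.L) {ℓ : ℝ} (hℓ : ℓ ∈ Ioo (g B.p₀) B.hi)
    {t : ℝ} (ht : g (B.θ (t, w)) = ℓ) : levelProj B.θ g ℓ w = B.θ (t, w) := by
  have h : hittingTime B.θ g ℓ w = t :=
    B.slabFlow'.hittingTime_eq_of_apply_eq (B.not_isMCriticalPt_of_eq_L hwL) (B.Ioo_subset_slab hℓ) ht
  rw [levelProj_apply, h]

/-- **The top of a level point is the starting point of `L`.** [cite: MilnorHCobordism1965, Thm. 4.1 (PDF p. 22)] -/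
theorem top_levelProj {w : W} (hwL : g w = B.L) (ℓ : ℝ) : B.top (levelProj B.θ g ℓ w) = w := by
  rw [levelProj_apply, top_def]
  exact B.isSmoothFlow.levelProj_apply_of_apply_eq B.preSlabFlow.mdifferentiable_f B.transversal_L hwL _

/-- The level point of a basin trajectory lies in the basin. [folklore] -/
theorem levelProj_mem_basin {w : W} (hw : w ∈ B.basin) (hwL : g w = B.L) {ℓ : ℝ}
    (hℓ : ℓ ∈ Ioo (g B.p₀) B.hi) : levelProj B.θ g ℓ w ∈ B.basin := by
  have h1 : g (levelProj B.θ g ℓ w) ≤ B.hi := by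
    rw [B.apply_levelProj_of_mem_basin hw hwL hℓ]; exact hℓ.2.le
  rw [levelProj_apply] at h1 ⊢
  exact (B.θ_mem_basin_iff (by rw [hwL]; exact B.L_lt_hi.le) h1).2 hw

/-- The level point hits `L` (it lies on a trajectory through `L`). [folklore] -/
theorem hits_L_levelProj {w : W} (hwL : g w = B.L) (ℓ : ℝ) : Hits B.θ g B.L (levelProj B.θ g ℓ w) := by
  rw [levelProj_apply]
  exact B.isSmoothFlow.hits_apply_iff.2 (hits_of_apply_eq (B.θ_zero w) hwL)

/-- **A point hitting `L` is the level point, at its own level, of its top.** [cite: MilnorHCobordism1965, Thm. 4.1 (PDF p. 22)] -/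
theorem levelProj_top_self {x : W} (hhit : Hits B.θ g B.L x) (hx : g x ∈ Ioo (g B.p₀) B.hi) :
    levelProj B.θ g (g x) (B.top x) = x := by
  have h := B.levelProj_eq_of_apply_θ_eq (B.apply_top hhit) hx (t := -hittingTime B.θ g B.L x)
    (by rw [B.θ_neg_hittingTime_top])
  rw [h, B.θ_neg_hittingTime_top]

/-! #### The transport of a boundary map to the level `L` -/

section Transport

/-- **The retraction onto `∂W` along the flow-out**, as a map on `W`. [cite: MilnorHCobordism1965, proof of Thm. 3.4 (PDF pp. 12–13)] -/
def ret (z : W) : W := B.S.Γ.ret z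

/-- Unfolding `ret`. [folklore] -/
theorem ret_def (z : W) : B.ret z = B.S.Γ.ret z := rfl

/-- `ret (push y) = y` for `y ∈ ∂W`. [folklore] -/
theorem ret_push_coe (y : (𝓡∂ (n + 1)).boundary W) : B.ret (B.push (y : W)) = y := by
  rw [push_coe]
  exact B.S.Γ.ret_Fl (B.depth_coe y) ⟨B.κ_pos.le, by linarith [B.κ_le, B.S.a'_lt, B.a'_pos]⟩

/-- The depth of a point of `{1 - a' ≤ g}` is `1 - g ≤ a'`. [folklore] -/
theorem depth_eq_of_ge {w : W} (hw : 1 - B.S.a' ≤ g w) : B.depth w = 1 - g w :=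
  B.depth_eq_of_le (by linarith [B.a'_le])

/-- `ret w ∈ ∂W` for `w ∈ {1 - a' ≤ g}`. [folklore] -/
theorem ret_mem_boundary {w : W} (hw : 1 - B.S.a' ≤ g w) : B.ret w ∈ (𝓡∂ (n + 1)).boundary W :=
  B.S.Γ.ret_mem_boundary (by rw [← depth_def, B.depth_eq_of_ge hw]; linarith [B.S.a'_lt])

/-- **A point of the level `L` is the push of its retraction.** [cite: Milnor1963, Thm. 3.1] -/
theorem push_ret_of_apply_eq_L {w : W} (hw : g w = B.L) : B.push (B.ret w) = w := by
  have : w ∈ range B.push := by rw [B.range_push]; exact hw.le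
  obtain ⟨z, rfl⟩ := this
  -- `z` is a boundary point: `push z` has depth `κ = pushShift (depth z)`, so `depth z = 0`
  have hz : B.depth z = 0 := by
    have h1 : B.depth (B.push z) = B.Γ.pushShift (B.depth z) := B.Γ.f_push z
    have h2 : B.depth (B.push z) = B.κ := by
      rw [B.depth_eq_of_ge (by rw [hw]; linarith [B.one_sub_a'_lt_L]), hw]; unfold L; ring
    have h3 : B.Γ.pushShift (B.depth z) = B.Γ.pushShift 0 := by
      rw [← h1, h2, B.Γ.pushShift_zero, pushDepth_eq]
    exact B.Γ.strictMono_pushShift.injective h3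
  have hzb : z ∈ (𝓡∂ (n + 1)).boundary W := (B.S.D.f_eq_zero_iff z).1 hz
  have := B.ret_push_coe ⟨z, hzb⟩
  simp only at this
  rw [this]

/-- A boundary point lies in the basin iff it is not a trace. [folklore] -/
theorem coe_mem_basin_iff (y : (𝓡∂ (n + 1)).boundary W) : (y : W) ∈ B.basin ↔ y ∉ B.traces := by
  rw [mem_traces_iff, not_not]

variable [Nonempty (BoundaryManifold.boundaryData n W).carrier]

/-- The boundary point below a point of `W` along the flow-out, as a point of `∂W` (junk off
the collar). [folklore] -/
def bret (w : W) : (𝓡∂ (n + 1)).boundary W :=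
  (BoundaryManifold.boundaryData n W).inclInv (B.ret w)

/-- `bret w = ret w` as points of `W`, on `{1 - a' ≤ g}`. [folklore] -/
theorem coe_bret {w : W} (hw : 1 - B.S.a' ≤ g w) : (B.bret w : W) = B.ret w :=
  (BoundaryManifold.boundaryData n W).incl_inclInv (B.ret_mem_boundary hw)

/-- `bret (push y) = y`. [folklore] -/
theorem bret_push_coe (y : (𝓡∂ (n + 1)).boundary W) : B.bret (B.push (y : W)) = y := by
  apply Subtype.ext
  rw [B.coe_bret (by rw [B.apply_push_coe]; exact B.one_sub_a'_lt_L.le), B.ret_push_coe]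

/-- **The transport to the level `L` of a self-map `χ` of `∂W`**:
`w ↦ push (χ (bret w))` — read `w ∈ L` as the push of a boundary point, apply `χ`, push back.
[cite: GriffithsHB1964Handlebody, §§3–6] -/
def transport (χ : (𝓡∂ (n + 1)).boundary W → (𝓡∂ (n + 1)).boundary W) (w : W) : W :=
  B.push (χ (B.bret w) : W)

/-- Unfolding `transport`. [folklore] -/
theorem transport_def (χ : (𝓡∂ (n + 1)).boundary W → (𝓡∂ (n + 1)).boundary W) (w : W) :
    B.transport χ w = B.push (χ (B.bret w) : W) := rfl

/-- **The transport on the push of a boundary point**: `transport χ (push y) = push (χ y)`. [folklore] -/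
theorem transport_push_coe (χ : (𝓡∂ (n + 1)).boundary W → (𝓡∂ (n + 1)).boundary W)
    (y : (𝓡∂ (n + 1)).boundary W) : B.transport χ (B.push (y : W)) = B.push (χ y : W) := by
  rw [transport_def, bret_push_coe]

/-- The transport takes values on the level `L`. [folklore] -/
theorem apply_transport (χ : (𝓡∂ (n + 1)).boundary W → (𝓡∂ (n + 1)).boundary W) (w : W) :
    g (B.transport χ w) = B.L := B.apply_push_coe _

/-- **Transports compose**: `transport χ' (transport χ w) = transport (χ' ∘ χ) w`. [folklore] -/
theorem transport_transport (χ χ' : (𝓡∂ (n + 1)).boundary W → (𝓡∂ (n + 1)).boundary W) (w : W) :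
    B.transport χ' (B.transport χ w) = B.transport (χ' ∘ χ) w := by
  rw [B.transport_def χ, transport_push_coe]; rfl

/-- The transport of the identity is the identity on `L`. [folklore] -/
theorem transport_id {w : W} (hw : g w = B.L) : B.transport id w = w := by
  rw [transport_def, id, B.coe_bret (by rw [hw]; exact B.one_sub_a'_lt_L.le), B.push_ret_of_apply_eq_L hw]

/-- **The transport of a bijection with inverse `χ'` is inverted by the transport of `χ'`**, on
`L`. [folklore] -/
theorem transport_leftInverse {χ χ' : (𝓡∂ (n + 1)).boundary W → (𝓡∂ (n + 1)).boundary W}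
    (h : LeftInverse χ' χ) {w : W} (hw : g w = B.L) : B.transport χ' (B.transport χ w) = w := by
  rw [transport_transport, h.comp_eq_id, B.transport_id hw]

/-- **The transport of a basin point of `L` by a map preserving the traces lies in the basin.**
[cite: MilnorHCobordism1965, Def. 3.9 (PDF p. 16)] -/
theorem transport_mem_basin {χ : (𝓡∂ (n + 1)).boundary W → (𝓡∂ (n + 1)).boundary W}
    (hχ : ∀ y, χ y ∈ B.traces ↔ y ∈ B.traces) {w : W} (hw : w ∈ B.basin) (hwL : g w = B.L) :
    B.transport χ w ∈ B.basin := by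
  have hwb : w = B.push (B.bret w : W) := by
    rw [B.coe_bret (by rw [hwL]; exact B.one_sub_a'_lt_L.le), B.push_ret_of_apply_eq_L hwL]
  have h1 : (B.bret w : W) ∈ B.basin := by
    rw [mem_basin_iff, B.coe_mem_unstableSet_iff, ← hwb]; exact hw
  have h2 : (χ (B.bret w) : W) ∈ B.basin := by
    rw [coe_mem_basin_iff] at h1 ⊢
    exact fun h => h1 ((hχ _).1 h)
  rw [transport_def, mem_basin_iff, ← B.coe_mem_unstableSet_iff]
  exact h2

/-- **The transport fixes the points of `L` whose boundary point is fixed.** [folklore] -/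
theorem transport_eq_self {χ : (𝓡∂ (n + 1)).boundary W → (𝓡∂ (n + 1)).boundary W} {w : W}
    (hw : g w = B.L) (h : χ (B.bret w) = B.bret w) : B.transport χ w = w := by
  rw [transport_def, h, B.coe_bret (by rw [hw]; exact B.one_sub_a'_lt_L.le), B.push_ret_of_apply_eq_L hw]

end Transport

end BasinSetting

end Literature.Topology.FourManifolds
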